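import Mathlib
import HarnessLib
import Summits.NavierStokesRegularity.NavierStokesRegularity.Theorems.QuarterLogPincerTruncationEdgeDefs
import Summits.NavierStokesRegularity.NavierStokesRegularity.Theorems.QuarterLogPincerTypeIQuantSubcubicExpTruncationEdgeEnvelopeCubeBudget
import Summits.NavierStokesRegularity.NavierStokesRegularity.Theorems.QuarterLogPincerTypeIQuantSubcubicExpTruncationEdgeRateFloor

/-!
# Crux `QuarterLogPincer.TypeIQuantSubcubicExp` (stmt-NavierStokesRegularity-24077), EDGE line `truncation_edge`
  (ns-idea-7 g8): the support obligations **T3 `stub_envelopeCubeBudget` and T4 `stub_rateFloor` BY NAME**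

Prover file (nsreg-C26-p1 g7, DIRECTOR-NS #259 (2); `--supports stmt-NavierStokesRegularity-24077`, helper).  With the
line objects re-homed in `Theorems/QuarterLogPincerTruncationEdgeDefs.lean` (p660448, verbatim), the two obligations of
`Cruxes/TypeIQuantSubcubicExp/Lines/truncation_edge.lean` that are support-sized are closed with their line signatures:

* `stub_envelopeCubeBudget : StubEnvelopeCubeBudget` — from `envelopeCubeBudget_of_hasTypeIDecay` (p660348; also proved
  independently in-file by the author, line v1.2);
* `stub_rateFloor : StubRateFloor` — from `rateFloor_of_isTypeIAncientMild_of_singularAt` (p660793, universal floor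
  constant `(16 C₁)⁻¹`).

After this file the line's edge `24077 ⇒ 22144 / 24453 / 24374 / (E1⁺) / TypeIDSSLiouville` is modulo T1
(`stub_farFieldTruncation`, THE INPUT) ONLY.  HONEST FRAME: support lemmas; 24077, 22144, W7 and NS regularity OPEN / not
proved; T1 is untouched.
-/

noncomputable section

-- the summit-side namespace repeats a component by design (D-0017)
set_option linter.dupNamespace false

namespace Summit.NavierStokesRegularity.NavierStokesRegularity.Cruxes.TypeIQuantSubcubicExp.TruncationEdge

open MeasureTheory Set Function Metric Filter Topology
open Literature.Analysis Literature.Analysis.FluidPDE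
open Summit.NavierStokesRegularity.NavierStokesRegularity.Cruxes.TypeIQuantSubcubicExp.ThinCascade (SingularAt)

/-- **T3 by name** — the registered-shape obligation `StubEnvelopeCubeBudget` of line `truncation_edge`:
`∀ A v, 0 ≤ A → HasTypeIDecay A v → EnvelopeCubeBudget v`. [cite: BarkerPrange2021, Cor. 1 (upper bound)] -/
theorem stub_envelopeCubeBudget : StubEnvelopeCubeBudget :=
  fun A v hA hdec => envelopeCubeBudget_of_hasTypeIDecay A v hA hdec

/-- **T4 by name** — the registered-shape obligation `StubRateFloor` of line `truncation_edge`: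
`∀ M v, IsTypeIAncientMild M v → SingularAt v 0 → RateFloor v` (Leray's floor in the KNSS gauge).
[cite: Leray1934, §19 (3.9) p. 224] -/
theorem stub_rateFloor : StubRateFloor := by
  obtain ⟨c, hc, h⟩ := rateFloor_of_isTypeIAncientMild_of_singularAt
  exact fun M v hv hsing => ⟨c, hc, h M v hv hsing⟩

end Summit.NavierStokesRegularity.NavierStokesRegularity.Cruxes.TypeIQuantSubcubicExp.TruncationEdge

end
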